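import Summits.QuantumFields.YangMills.Theorems.BalabanUVNodesN27AtSpineReadingOfRecord13CoPHVCutFSC
import Summits.QuantumFields.YangMills.Theorems.BalabanUVNodesN20OffLiveOneTermReading
import Literature.MathematicalPhysics.QuantumFieldTheory.Balaban1983to89.Node00.Record13SepCoPHV

/-!
# ★ THE (B)-FREE SPINE BODY — ONE CONCLUSION CURRENCY SERVING K3⁷, K3⁸ (rev 28, recipe (δⱽ)) AND EVERY VERSION SLOT, with this lineage's pinned composer storey UC4 and the
# off-live one-term reading RE-CONCLUDED IN IT
# (cell `pub-ymgap`, HUMAN RULING D-0062 Track A, R134 seat `pub-ymgap-dag-n27-c` (N27 B5 composite, s2) gen 15, HOME trigger (t3⁗) «plan K3 v6 ∕ rev 28» (pub-ymgap-plan g85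
# `D85-REV28/` SHAPE SHEET, K3⁸ `SpineGivenEndpointR13SepCoPHV` over DEF-1's version slot `Node00/Record13SepCoPHV.lean` p620607); `--kind proof --supports stmt-QuantumFields-20544 --as
# helper`; COUNT-NEUTRAL; THEOREMS ONLY, 0 `def`, 0 `sorry`; `N`-generic, `K₀`-generic, regime-generic; NO Theses import)

WHY.  B5 at a datum `D` under the targets' prefix is `T4ApexHybrid.HybridNE7Under D Hβ = ((B) D.C → Hβ → ForSmallCouplings D (fun g₀ ↦ StringwiseHybridNE7 (D.scheme g₀)))`
(`T4ContinuumYM4Torus.underHypotheses_iff`, definitional).  Under the rev-28 recipe (δⱽ) the datum of record becomes `Node00.datumOfRecord₁₃SepCoPHV F N θ h v` for EVERY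
revision `v` of its positive-level densities; by DEF-1's `rfl` faces ONLY the antecedent `(B) D.C` moves with `v` — `ForSmallCouplings` (reads `Tuned` = the flow) and the Wilson
schemes `D.scheme` are the record's.  This lineage's pinned storeys never READ (B) or the endpoint binder: they are threaded from `HybridNE7Under`'s antecedent into the displayed
prefix-keyed rows (v5's two stub-2 faces at the pins: the N19′ rows `h19`∕`h19'`∕`htarget` and the N27x rows `hx`∕`hx'`) and otherwise discarded.  So the storeys are re-concluded
here in the **(B)-FREE BODY** `ForSmallCouplings (datumOfRecord₁₃CoPH F N θ hP) (fun g₀ ↦ StringwiseHybridNE7 ((datumOfRecord₁₃CoPH F N θ hP).scheme g₀))` with those rows read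
(B)-FREE (plan k3v6 §1V's `KeyedCoreEdgeHolderD4BFree` ∕ `KeyedExtractionBFree` SHAPES — spelled, no def minted): ONE conclusion that gives the old currency
`Spine (IsRecordOfRecord₁₃CCoPHOn Rg)` (§2), K3⁷'s display on the separated provisos (§3) AND K3⁸'s display at every slot `v` (§3) by `fun _ _ ↦`.  A K3⁷-shaped conclusion does NOT
give the K3⁸ shape by post-composition (it wants `(B)` at the record, the slot offers `(B)` at the revised datum — dag-n17-w2's `hBdown`); the body does, with no `hBdown`.

WHAT IS KERNEL-CHECKED ([bookkeeping] throughout).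
* §0 generic datum: `forSmallCouplings_stringwise_of_spineNodes_tail` (dag-n27-a's `stringHybridNE7_of_spineNodes_tail` under `ForSmallCouplings.mono` — `hybridNE7Under_of_spineNodes_tail`
  without the prefix) · `hybridNE7Under_of_forSmallCouplings_stringwise` (body ⇒ `HybridNE7Under D Hβ`, every `Hβ`).
* §1 abstract key (dag-n19-w3's `forall_keyed_hybridNE7Under_of_fscFacesP` shape, p595910, with `hrates`∕`h19`∕`hx` (B)-FREE): `forall_keyed_bodyBFree_of_bFreeFacesP`.
* §2 Stage 13, guard `G`: `bodyBFree₁₃CoPH_of_keyedFacesP_bFree` · `spine_rec13CCoPHOn_of_bodyBFree` (old currency recovered) · `bodyBFree₁₃CoPH_of_split` (live ∕ off-live).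
* §3 THE TWO ITEM DISPLAYS FROM ONE BODY: `forall_sep_hybridNE7Under_of_bodyBFree` (K3⁷'s shape on `Provisos₁₃SepCoPH`, any `N`) · ★★★ `forall_revision₁₃_hybridNE7Under_of_bodyBFree` (K3⁸'s
  shape: every `v : Node00.Revision₁₃ F N θ h`, at `Node00.datumOfRecord₁₃SepCoPHV F N θ h v`; DEF-1's faces, `Iff.rfl`).
* §4 UC4ᴮ: `bodyBFree₁₃CoPH_at_crOfRecord₁₃VAt_cut_of_keyedFacesP_bFree` · `bodyBFree₁₃CoPH_live_at_crOfRecord₁₃VAt_cut_of_keyedFacesP_bFree` (UC4 §1∕§2 p601319 with `hrates`∕`h19`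
  (B)-free; N27x = UC §0's theorem `keyedExtraction_crOfRecord₁₃VAt_cut`, already (B)-free; dag-n20-d's transfers p590105).
* §5 off the live line at dag-n20-w1's ONE-TERM reading `crOneTerm₁₃ K₀` (p598780): `bodyBFree₁₃CoPH_offLive_crOneTerm₁₃_of_target_bFree` (ONE (B)-free Target row `htarget`).

HONEST FRAMING.  COMPOSITE-node bookkeeping BY NAME (`ForSmallCouplings.mono ∕ .and ∕ .of_forall`, `Iff.rfl` ∕ `rfl` faces); every displayed antecedent (rates, N19′ edge, N27x,
keyed N20 ∕ N21 witnesses, `hζm`, the selector pin, the Target row) is a HYPOTHESIS inhabited for no family today (K0⁷ `Record13SepCoPHInhabited` OPEN); `jc sh rr P` FREE; nothing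
of Bałaban's asserted or instantiated; NE-estimates NOT proved, none in print for d = 4; N19 ∕ N20 ∕ N21 ∕ N27 NOT discharged; K3⁷ 20544 ASIDE, K3⁸ `SpineGivenEndpointR13SepCoPHV` = stmt-QuantumFields-27366 OPEN and NOT claimed (rev
28∕29, v1.1 docstring note); the plan's skeletons v5 941dddb108cbaacf ∕ v6 981b468a15e383a3 untouched; counts UNMOVED (typed 28∕28 · discharged 5∕27, A 5∕28); one finite four-torus programme at fixed
`ε` — R4 is the CONDITIONAL finite-𝕋⁴ rung `BalabanLadder.UV` only: NOT ℝ⁴, NOT infinite volume, NOT OS, NOT a mass gap, NOT Clay.  No decl below carries a cite tag.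
-/

set_option autoImplicit false

namespace Summit.QuantumFields.YangMills.Theorems.BalabanUVNodesN27SpineRecord

open scoped BigOperators
open Literature.MathematicalPhysics.QuantumFieldTheory.Balaban1983to89
open Literature.MathematicalPhysics.QuantumFieldTheory.Balaban1983to89.T4Continuum
open Literature.MathematicalPhysics.QuantumFieldTheory.Balaban1983to89.Node00
open T4WeightBudget (RelWeightBound)
open T4IndicatorShell (ShellWeightBound)
open T4ContinuumYM4Torus (ForSmallCouplings underHypotheses_iff)
open T4ApexHybrid (HybridNE7Under StringwiseHybridNE7)
open Summit.QuantumFields.BalabanUV.T4Continuum.Spine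
open YMDAG.UVSplit
open NE7 (Target)
open Summit.QuantumFields.YangMills.BalabanUVNodes.SpineCanonicalWeights (core_nonneg_of_shellWeightBound)
open Summit.QuantumFields.YangMills.BalabanUVNodes.N19TargetClassWeightsE1Keyed
open Summit.QuantumFields.YangMills.BalabanUVNodes.N21KeyedShellWeightShellZero (zeta_nonneg_of_provisos₁₃CoPH)
open Summit.QuantumFields.YangMills.BalabanUVNodes.N20OffLiveOneTermReading (crOneTerm₁₃ relWeightBound_crOneTerm₁₃ shellWeightBound_crOneTerm₁₃ extraction_crOneTerm₁₃
  core_crOneTerm₁₃_iff_target)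

/-! ## §0 Generic datum: the children's package WITHOUT the prefix ⇒ the (B)-free body; the body ⇒ B5 under ANY prefix -/

section Generic

variable {F : T4Family} {G : Type*} [GaugeGroup G] [MeasurableSpace G] [HaarData G]

/-- ★ **THE CHILDREN'S PACKAGE FOR ALL SMALL COUPLINGS ⇒ THE (B)-FREE SPINE BODY** (dag-n27-a's `hybridNE7Under_of_spineNodes_tail` with the targets' two antecedents DROPPED on both sides:
`stringHybridNE7_of_spineNodes_tail` per string inside `ForSmallCouplings.mono`). [bookkeeping] -/
theorem forSmallCouplings_stringwise_of_spineNodes_tail (D : FiniteEpsData F G)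
    (h : ForSmallCouplings D fun g₀ => ∀ os : List (ULoop F),
      ∃ (ι : Type) (_ : DecidableEq ι) (l₀ vol : ℝ) (K₀ : ℕ) (T : ℕ → Finset ι) (A B shA shB : ℕ → ℝ → ι → ℝ)
        (Bad : ℕ → ℝ → Finset ι) (W Wsh δ : ℕ → ℝ),
        0 < l₀ ∧ 0 < vol ∧
          RelWeightBound l₀ T A B Bad W ∧
          ShellWeightBound l₀ T A B shA shB Wsh ∧
          NE7.Core l₀ vol T Bad (fun K t τ => A K t τ - shA K t τ) (fun K t τ => B K t τ - shB K t τ) δ ∧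
          Summable δ ∧
          (∀ K t, |t| ≤ l₀ → T4GenFunBounds.schemeZ (D.scheme g₀) os (K₀ + K) t = ∑ τ ∈ T K, A K t τ) ∧
          (∀ K t, |t| ≤ l₀ → T4GenFunBounds.schemeZ (D.scheme g₀) os (K₀ + K + 1) t = ∑ τ ∈ T K, B K t τ)) :
    ForSmallCouplings D fun g₀ => StringwiseHybridNE7 (D.scheme g₀) :=
  h.mono fun g₀ hg os => by
    obtain ⟨ι, _, l₀, vol, K₀, T, A, B, shA, shB, Bad, W, Wsh, δ, hl₀, hvol, h20, h21, h19, hδ, hE1, hE2⟩ := hg os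
    obtain ⟨K₁, hS⟩ := stringHybridNE7_of_spineNodes_tail (D.scheme g₀) os K₀ h20 h21 ⟨δ, h19, hδ⟩ hE1 hE2
    exact ⟨l₀, vol, K₀ + K₁, hl₀, hvol, hS⟩

/-- ★ **THE (B)-FREE BODY ⇒ B5 UNDER ANY PREFIX** (`underHypotheses_iff`: the two antecedents discarded). [bookkeeping] -/
theorem hybridNE7Under_of_forSmallCouplings_stringwise (D : FiniteEpsData F G) (h : ForSmallCouplings D fun g₀ => StringwiseHybridNE7 (D.scheme g₀))
    (Hβ : Prop) : HybridNE7Under D Hβ :=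
  (underHypotheses_iff D Hβ _).mpr fun _ _ => h

end Generic

/-! ## §1 Abstract key: the (B)-free body at a keyed datum from N20 ∕ N21 (∀ `g₀`) and the (B)-FREE `ForSmallCouplings`-guarded rates ∕ N19′ ∕ extraction faces -/

section Abstract

universe u

variable {N : ℕ} [NeZero N] {Θ : T4Family → Type u} (Hp : ∀ {F : T4Family}, Θ F → Prop) (Adm : ∀ {F : T4Family}, Θ F → Prop)
  (datumOf : ∀ {F : T4Family} (θ : Θ F), Hp θ → Datum F N)
  (cr : ∀ {F : T4Family} (θ : Θ F), Hp θ → (ℕ → ℝ) → List (ULoop F) → SpineCarriers)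
  (rr : ∀ {F : T4Family} (θ : Θ F), Hp θ → (ℕ → ℝ) → List (ULoop F) → RateCarriers N)
  (P : ∀ {F : T4Family}, Datum F N → RateCarriers N → Prop)

/-- ★ **THE (B)-FREE BODY AT A KEYED DATUM FROM N20, N21 AND THE (B)-FREE `ForSmallCouplings`-GUARDED FACES** — dag-n19-w3's `forall_keyed_hybridNE7Under_of_fscFacesP` (p595910) with the
antecedents `(B) → EndpointExistence →` of `hrates` ∕ `h19` ∕ `hx` DROPPED (plan k3v6 §1V's `…BFree` shapes) and the conclusion the BODY (no prefix); carriers `:= cr θ hP g₀ os` field by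
field, the N19′ witness joined INSIDE `ForSmallCouplings` (`.and` ∕ `.mono`). [bookkeeping] -/
theorem forall_keyed_bodyBFree_of_bFreeFacesP
    (h20 : ∀ (F : T4Family) (θ : Θ F) (hP : Hp θ), Adm θ → ∀ (g₀ : ℕ → ℝ) (os : List (ULoop F)),
      RelWeightBound (cr θ hP g₀ os).l₀ (cr θ hP g₀ os).T (cr θ hP g₀ os).A (cr θ hP g₀ os).B (cr θ hP g₀ os).Bad (cr θ hP g₀ os).W)
    (h21 : ∀ (F : T4Family) (θ : Θ F) (hP : Hp θ), Adm θ → ∀ (g₀ : ℕ → ℝ) (os : List (ULoop F)),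
      ShellWeightBound (cr θ hP g₀ os).l₀ (cr θ hP g₀ os).T (cr θ hP g₀ os).A (cr θ hP g₀ os).B (cr θ hP g₀ os).shA (cr θ hP g₀ os).shB (cr θ hP g₀ os).Wsh)
    (hrates : ∀ (F : T4Family) (θ : Θ F) (hP : Hp θ), Adm θ →
      ForSmallCouplings (datumOf θ hP) fun g₀ => ∀ os : List (ULoop F), P (datumOf θ hP) (rr θ hP g₀ os))
    (h19 : ∀ (F : T4Family) (θ : Θ F) (hP : Hp θ), Adm θ →
      ForSmallCouplings (datumOf θ hP) fun g₀ => ∀ os : List (ULoop F), P (datumOf θ hP) (rr θ hP g₀ os) → letI := (cr θ hP g₀ os).dec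
        ∃ δ : ℕ → ℝ, NE7.Core (cr θ hP g₀ os).l₀ (cr θ hP g₀ os).vol (cr θ hP g₀ os).T (cr θ hP g₀ os).Bad
          (fun K t τ => (cr θ hP g₀ os).A K t τ - (cr θ hP g₀ os).shA K t τ) (fun K t τ => (cr θ hP g₀ os).B K t τ - (cr θ hP g₀ os).shB K t τ) δ ∧ Summable δ)
    (hx : ∀ (F : T4Family) (θ : Θ F) (hP : Hp θ), Adm θ →
      ForSmallCouplings (datumOf θ hP) fun g₀ => ∀ os : List (ULoop F),
        0 < (cr θ hP g₀ os).l₀ ∧ 0 < (cr θ hP g₀ os).vol ∧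
        (∀ (K : ℕ) (t : ℝ), |t| ≤ (cr θ hP g₀ os).l₀ →
          T4GenFunBounds.schemeZ ((datumOf θ hP).scheme g₀) os ((cr θ hP g₀ os).K₀ + K) t = ∑ τ ∈ (cr θ hP g₀ os).T K, (cr θ hP g₀ os).A K t τ) ∧
        (∀ (K : ℕ) (t : ℝ), |t| ≤ (cr θ hP g₀ os).l₀ →
          T4GenFunBounds.schemeZ ((datumOf θ hP).scheme g₀) os ((cr θ hP g₀ os).K₀ + K + 1) t = ∑ τ ∈ (cr θ hP g₀ os).T K, (cr θ hP g₀ os).B K t τ))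
    (F : T4Family) (θ : Θ F) (hP : Hp θ) (hθ : Adm θ) :
    ForSmallCouplings (datumOf θ hP) fun g₀ => StringwiseHybridNE7 ((datumOf θ hP).scheme g₀) := by
  refine forSmallCouplings_stringwise_of_spineNodes_tail (datumOf θ hP) ?_
  refine (((hrates F θ hP hθ).and (h19 F θ hP hθ)).and (hx F θ hP hθ)).mono fun g₀ hg os => ?_
  obtain ⟨δ, hc, hδ⟩ := hg.1.2 os (hg.1.1 os)
  obtain ⟨hl₀, hvol, hZA, hZB⟩ := hg.2 os
  exact ⟨(cr θ hP g₀ os).ι, (cr θ hP g₀ os).dec, (cr θ hP g₀ os).l₀, (cr θ hP g₀ os).vol, (cr θ hP g₀ os).K₀, (cr θ hP g₀ os).T, (cr θ hP g₀ os).A,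
    (cr θ hP g₀ os).B, (cr θ hP g₀ os).shA, (cr θ hP g₀ os).shB, (cr θ hP g₀ os).Bad, (cr θ hP g₀ os).W, (cr θ hP g₀ os).Wsh, δ, hl₀, hvol,
    h20 F θ hP hθ g₀ os, h21 F θ hP hθ g₀ os, hc, hδ, hZA, hZB⟩

end Abstract

/-! ## §2 Stage 13 (`CoPH` key, guard `G`): the body from the keyed faces; the old currency recovered; the live ∕ off-live split -/

section Stage13

variable {N : ℕ} [NeZero N]
  (cr : (F : T4Family) → (θ : Stage13HParams F N) → θ.Provisos₁₃CoPH F N → (ℕ → ℝ) → List (ULoop F) → SpineCarriers)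
  (rr : (F : T4Family) → (θ : Stage13HParams F N) → θ.Provisos₁₃CoPH F N → (ℕ → ℝ) → List (ULoop F) → RateCarriers N)
  (G : (F : T4Family) → Stage13HParams F N → Prop) (P : ∀ {F : T4Family}, Datum F N → RateCarriers N → Prop)

/-- ★ **THE (B)-FREE BODY ON A GUARDED REGIME AT STAGE 13 FROM THE KEYED FACES** (§1 at the `CoPH` key; dag-n19-w3's `keyedGuarded₁₃CoPH_of_keyedFacesP_fsc` with `hrates` ∕ `h19` ∕ `hx`
(B)-free and the conclusion the body). [bookkeeping] -/
theorem bodyBFree₁₃CoPH_of_keyedFacesP_bFree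
    (h20 : ∀ (F : T4Family) (θ : Stage13HParams F N) (hP : θ.Provisos₁₃CoPH F N), G F θ → θ.Admissible F N → ∀ (g₀ : ℕ → ℝ) (os : List (ULoop F)),
      RelWeightBound (cr F θ hP g₀ os).l₀ (cr F θ hP g₀ os).T (cr F θ hP g₀ os).A (cr F θ hP g₀ os).B (cr F θ hP g₀ os).Bad (cr F θ hP g₀ os).W)
    (h21 : ∀ (F : T4Family) (θ : Stage13HParams F N) (hP : θ.Provisos₁₃CoPH F N), G F θ → θ.Admissible F N → ∀ (g₀ : ℕ → ℝ) (os : List (ULoop F)),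
      ShellWeightBound (cr F θ hP g₀ os).l₀ (cr F θ hP g₀ os).T (cr F θ hP g₀ os).A (cr F θ hP g₀ os).B (cr F θ hP g₀ os).shA (cr F θ hP g₀ os).shB
        (cr F θ hP g₀ os).Wsh)
    (hrates : ∀ (F : T4Family) (θ : Stage13HParams F N) (hP : θ.Provisos₁₃CoPH F N), G F θ → θ.Admissible F N →
      ForSmallCouplings (datumOfRecord₁₃CoPH F N θ hP) fun g₀ => ∀ os : List (ULoop F), P (datumOfRecord₁₃CoPH F N θ hP) (rr F θ hP g₀ os))
    (h19 : ∀ (F : T4Family) (θ : Stage13HParams F N) (hP : θ.Provisos₁₃CoPH F N), G F θ → θ.Admissible F N →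
      ForSmallCouplings (datumOfRecord₁₃CoPH F N θ hP) fun g₀ => ∀ os : List (ULoop F),
        P (datumOfRecord₁₃CoPH F N θ hP) (rr F θ hP g₀ os) → letI := (cr F θ hP g₀ os).dec
          ∃ δ : ℕ → ℝ, NE7.Core (cr F θ hP g₀ os).l₀ (cr F θ hP g₀ os).vol (cr F θ hP g₀ os).T (cr F θ hP g₀ os).Bad
            (fun K t τ => (cr F θ hP g₀ os).A K t τ - (cr F θ hP g₀ os).shA K t τ) (fun K t τ => (cr F θ hP g₀ os).B K t τ - (cr F θ hP g₀ os).shB K t τ) δ ∧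
            Summable δ)
    (hx : ∀ (F : T4Family) (θ : Stage13HParams F N) (hP : θ.Provisos₁₃CoPH F N), G F θ → θ.Admissible F N →
      ForSmallCouplings (datumOfRecord₁₃CoPH F N θ hP) fun g₀ => ∀ os : List (ULoop F),
        0 < (cr F θ hP g₀ os).l₀ ∧ 0 < (cr F θ hP g₀ os).vol ∧
        (∀ (K : ℕ) (t : ℝ), |t| ≤ (cr F θ hP g₀ os).l₀ →
          T4GenFunBounds.schemeZ ((datumOfRecord₁₃CoPH F N θ hP).scheme g₀) os ((cr F θ hP g₀ os).K₀ + K) t =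
            ∑ τ ∈ (cr F θ hP g₀ os).T K, (cr F θ hP g₀ os).A K t τ) ∧
        (∀ (K : ℕ) (t : ℝ), |t| ≤ (cr F θ hP g₀ os).l₀ →
          T4GenFunBounds.schemeZ ((datumOfRecord₁₃CoPH F N θ hP).scheme g₀) os ((cr F θ hP g₀ os).K₀ + K + 1) t =
            ∑ τ ∈ (cr F θ hP g₀ os).T K, (cr F θ hP g₀ os).B K t τ))
    (F : T4Family) (θ : Stage13HParams F N) (hP : θ.Provisos₁₃CoPH F N) (hG : G F θ) (hθ : θ.Admissible F N) :
    ForSmallCouplings (datumOfRecord₁₃CoPH F N θ hP) fun g₀ => StringwiseHybridNE7 ((datumOfRecord₁₃CoPH F N θ hP).scheme g₀) :=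
  forall_keyed_bodyBFree_of_bFreeFacesP (Θ := fun F => Stage13HParams F N) (fun θ => θ.Provisos₁₃CoPH _ N) (fun θ => G _ θ ∧ θ.Admissible _ N)
    (fun θ h => datumOfRecord₁₃CoPH _ N θ h) (fun θ h => cr _ θ h) (fun θ h => rr _ θ h) P
    (fun F θ hP hA => h20 F θ hP hA.1 hA.2) (fun F θ hP hA => h21 F θ hP hA.1 hA.2) (fun F θ hP hA => hrates F θ hP hA.1 hA.2)
    (fun F θ hP hA => h19 F θ hP hA.1 hA.2) (fun F θ hP hA => hx F θ hP hA.1 hA.2) F θ hP ⟨hG, hθ⟩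

/-- ★ **THE OLD CURRENCY RECOVERED**: the (B)-free body on the guarded regime ⇒ `Spine` at the regime record class `IsRecordOfRecord₁₃CCoPHOn F N G` (the targets' two antecedents
discarded; XXXVIᶜᵒᵖᴴ `spine_rec13CCoPHOn_iff_forall_guarded`). [bookkeeping] -/
theorem spine_rec13CCoPHOn_of_bodyBFree
    (h : ∀ (F : T4Family) (θ : Stage13HParams F N) (hP : θ.Provisos₁₃CoPH F N), G F θ → θ.Admissible F N →
      ForSmallCouplings (datumOfRecord₁₃CoPH F N θ hP) fun g₀ => StringwiseHybridNE7 ((datumOfRecord₁₃CoPH F N θ hP).scheme g₀)) :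
    Spine (N := N) fun F D w => Node00.IsRecordOfRecord₁₃CCoPHOn F N G D w :=
  (spine_rec13CCoPHOn_iff_forall_guarded G).mpr fun F θ hP hG hθ => hybridNE7Under_of_forSmallCouplings_stringwise _ (h F θ hP hG hθ) _

/-- ★ **THE LIVE ∕ OFF-LIVE SPLIT IN THE BODY CURRENCY** (U `spine_rec13CCoPHOn_of_split`'s twin; `by_cases`). [bookkeeping] -/
theorem bodyBFree₁₃CoPH_of_split (L : (F : T4Family) → Stage13HParams F N → Prop)
    (hlive : ∀ (F : T4Family) (θ : Stage13HParams F N) (hP : θ.Provisos₁₃CoPH F N), (G F θ ∧ L F θ) → θ.Admissible F N →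
      ForSmallCouplings (datumOfRecord₁₃CoPH F N θ hP) fun g₀ => StringwiseHybridNE7 ((datumOfRecord₁₃CoPH F N θ hP).scheme g₀))
    (hoff : ∀ (F : T4Family) (θ : Stage13HParams F N) (hP : θ.Provisos₁₃CoPH F N), (G F θ ∧ ¬ L F θ) → θ.Admissible F N →
      ForSmallCouplings (datumOfRecord₁₃CoPH F N θ hP) fun g₀ => StringwiseHybridNE7 ((datumOfRecord₁₃CoPH F N θ hP).scheme g₀))
    (F : T4Family) (θ : Stage13HParams F N) (hP : θ.Provisos₁₃CoPH F N) (hG : G F θ) (hθ : θ.Admissible F N) :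
    ForSmallCouplings (datumOfRecord₁₃CoPH F N θ hP) fun g₀ => StringwiseHybridNE7 ((datumOfRecord₁₃CoPH F N θ hP).scheme g₀) := by
  by_cases hL : L F θ
  · exact hlive F θ hP ⟨hG, hL⟩ hθ
  · exact hoff F θ hP ⟨hG, hL⟩ hθ

/-! ## §3 THE TWO ITEM DISPLAYS FROM ONE BODY: K3⁷'s shape on the separated provisos, K3⁸'s shape at EVERY version slot (rev 28, recipe (δⱽ); DEF-1's faces) -/

/-- ★★ **K3⁷'s DISPLAY FROM THE BODY** (any `N`; `hP := h.toCore`, `datumOfRecord₁₃SepCoPH F N θ h = datumOfRecord₁₃CoPH F N θ h.toCore` by `rfl`; the two antecedents discarded).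
At `N = 2`, `G := θ.ZhUnity F 2 ∧ θ.SlotsNondegenerate₁₃ F 2` the conclusion IS the rev-27 item's text. [bookkeeping] -/
theorem forall_sep_hybridNE7Under_of_bodyBFree
    (h : ∀ (F : T4Family) (θ : Stage13HParams F N) (hP : θ.Provisos₁₃CoPH F N), G F θ → θ.Admissible F N →
      ForSmallCouplings (datumOfRecord₁₃CoPH F N θ hP) fun g₀ => StringwiseHybridNE7 ((datumOfRecord₁₃CoPH F N θ hP).scheme g₀)) :
    ∀ (F : T4Family) (θ : Stage13HParams F N) (h : θ.Provisos₁₃SepCoPH F N), G F θ → θ.Admissible F N →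
      B16.EndStatementBPrinted (datumOfRecord₁₃SepCoPH F N θ h).C → DagBinding.EndpointExistence (datumOfRecord₁₃SepCoPH F N θ h).C.toB12 →
        HybridNE7Under (datumOfRecord₁₃SepCoPH F N θ h) (DagBinding.EndpointExistence (datumOfRecord₁₃SepCoPH F N θ h).C.toB12) :=
  fun F θ hs hG hθ _ _ => hybridNE7Under_of_forSmallCouplings_stringwise _ (h F θ hs.toCore hG hθ) _

/-- ★★★ **K3⁸'s DISPLAY FROM THE BODY, AT EVERY VERSION SLOT** (rev 28, recipe (δⱽ)): for every revision `v : Node00.Revision₁₃ F N θ h` of the record's positive-level densities, B5 at the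
revised datum `Node00.datumOfRecord₁₃SepCoPHV F N θ h v` under its own prefix — because the body is SLOT-INVARIANT (DEF-1 p620607: `ForSmallCouplings` reads `Tuned` = the flow and the
Wilson schemes are the record's, `tuned_∕scheme_datumOfRecord₁₃SepCoPHV`, both `rfl`) and the slot's two antecedents are discarded.  At `N = 2`, `G :=` the guard, the conclusion IS the
rev-28 item's text `SpineGivenEndpointR13SepCoPHV` (pub-ymgap-plan `D85-REV28/`, text ddfbd3977d4b8f75) WITHOUT its name; no `hBdown` (dag-n17-w2 §3) is needed on this road.
[bookkeeping] -/
theorem forall_revision₁₃_hybridNE7Under_of_bodyBFree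
    (h : ∀ (F : T4Family) (θ : Stage13HParams F N) (hP : θ.Provisos₁₃CoPH F N), G F θ → θ.Admissible F N →
      ForSmallCouplings (datumOfRecord₁₃CoPH F N θ hP) fun g₀ => StringwiseHybridNE7 ((datumOfRecord₁₃CoPH F N θ hP).scheme g₀)) :
    ∀ (F : T4Family) (θ : Stage13HParams F N) (h : θ.Provisos₁₃SepCoPH F N) (v : Node00.Revision₁₃ F N θ h), G F θ → θ.Admissible F N →
      B16.EndStatementBPrinted (Node00.datumOfRecord₁₃SepCoPHV F N θ h v).C →
        DagBinding.EndpointExistence (Node00.datumOfRecord₁₃SepCoPHV F N θ h v).C.toB12 →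
          HybridNE7Under (Node00.datumOfRecord₁₃SepCoPHV F N θ h v) (DagBinding.EndpointExistence (Node00.datumOfRecord₁₃SepCoPHV F N θ h v).C.toB12) :=
  fun F θ hs v hG hθ _ _ =>
    hybridNE7Under_of_forSmallCouplings_stringwise (Node00.datumOfRecord₁₃SepCoPHV F N θ hs v)
      (show ForSmallCouplings (Node00.datumOfRecord₁₃SepCoPHV F N θ hs v) (fun g₀ => StringwiseHybridNE7 ((Node00.datumOfRecord₁₃SepCoPHV F N θ hs v).scheme g₀)) from
        h F θ hs.toCore hG hθ) _

/-- ★★ … and B5 at the revised datum under ANY prefix `Hβ` (e.g. a Thm-1-keyed display), every slot. [bookkeeping] -/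
theorem forall_revision₁₃_hybridNE7Under_of_bodyBFree' (Hβ : ∀ {F : T4Family}, Datum F N → Prop)
    (h : ∀ (F : T4Family) (θ : Stage13HParams F N) (hP : θ.Provisos₁₃CoPH F N), G F θ → θ.Admissible F N →
      ForSmallCouplings (datumOfRecord₁₃CoPH F N θ hP) fun g₀ => StringwiseHybridNE7 ((datumOfRecord₁₃CoPH F N θ hP).scheme g₀))
    (F : T4Family) (θ : Stage13HParams F N) (hs : θ.Provisos₁₃SepCoPH F N) (v : Node00.Revision₁₃ F N θ hs) (hG : G F θ) (hθ : θ.Admissible F N) :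
    HybridNE7Under (Node00.datumOfRecord₁₃SepCoPHV F N θ hs v) (Hβ (Node00.datumOfRecord₁₃SepCoPHV F N θ hs v)) :=
  hybridNE7Under_of_forSmallCouplings_stringwise (Node00.datumOfRecord₁₃SepCoPHV F N θ hs v)
    (show ForSmallCouplings (Node00.datumOfRecord₁₃SepCoPHV F N θ hs v) (fun g₀ => StringwiseHybridNE7 ((Node00.datumOfRecord₁₃SepCoPHV F N θ hs v).scheme g₀)) from
      h F θ hs.toCore hG hθ) _

end Stage13

/-! ## §4 UC4ᴮ — this lineage's pinned composer storey at the per-tuple-cut V reading `crOfRecord₁₃VAt K₀ (jc …) sh`, rates and N19′ edge read (B)-FREE, concluded in the body -/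

section Pinned

variable {N : ℕ} [NeZero N] (K₀ : ℕ)
  (jc : (F : T4Family) → (θ : Stage13HParams F N) → θ.Provisos₁₃CoPH F N → (ℕ → ℝ) → List (ULoop F) → ℕ → ℕ)
  (sh : ShellSplit₁₃CoPH N K₀) (Rg : (F : T4Family) → Stage13HParams F N → Prop)
  (rr : (F : T4Family) → (θ : Stage13HParams F N) → θ.Provisos₁₃CoPH F N → (ℕ → ℝ) → List (ULoop F) → RateCarriers N)
  (P : ∀ {F : T4Family}, Datum F N → RateCarriers N → Prop)

/-- ★★ **UC4 §1 IN THE BODY CURRENCY** — any regime `Rg`, `hsel` per tuple: keyed N20 ∕ N21 witnesses (∀ `g₀`), the RATES `P` at `rr` and the N19′ edge `ForSmallCouplings`-guarded and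
(B)-FREE, the law `hζm` ((H-U) `localBgMeasurable`, `0 ≤ ζ` `zeta_nonneg_of_provisos₁₃CoPH` supplied; N27x = UC §0 `keyedExtraction_crOfRecord₁₃VAt_cut`) ⇒ the (B)-free body on `Rg`.
Every displayed antecedent a HYPOTHESIS (0∕1 today). [bookkeeping] -/
theorem bodyBFree₁₃CoPH_at_crOfRecord₁₃VAt_cut_of_keyedFacesP_bFree
    (hsel : ∀ (F : T4Family) (θ : Stage13HParams F N), θ.Provisos₁₃CoPH F N → Rg F θ → θ.Admissible F N →
      ∃ E : B12.RunParams → ℝ, θ.ppSel = ppSelLiveOfRecord F N θ.ν θ.τ9 E (wOfRecord₉ F N θ.toStage9Params))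
    (hζm : ∀ (F : T4Family) (θ : Stage13HParams F N), θ.Provisos₁₃CoPH F N → Rg F θ → θ.Admissible F N → ZetaMeasurable F N θ.ζ)
    (h20 : ∀ (F : T4Family) (θ : Stage13HParams F N) (hP : θ.Provisos₁₃CoPH F N), Rg F θ → θ.Admissible F N → ∀ (g₀ : ℕ → ℝ) (os : List (ULoop F)),
      ∃ W : ℕ → ℝ, RelWeightBound 1 (classSet₁₃ θ K₀ g₀) (weightA₁₃ θ hP K₀ g₀ os) (weightB₁₃ θ hP K₀ g₀ os) (badClass₁₃ θ K₀ g₀ (jc F θ hP g₀ os)) W)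
    (h21 : ∀ (F : T4Family) (θ : Stage13HParams F N) (hP : θ.Provisos₁₃CoPH F N), Rg F θ → θ.Admissible F N → ∀ (g₀ : ℕ → ℝ) (os : List (ULoop F)),
      ∃ Wsh : ℕ → ℝ, ShellWeightBound 1 (classSet₁₃ θ K₀ g₀) (weightA₁₃ θ hP K₀ g₀ os) (weightB₁₃ θ hP K₀ g₀ os) (sh F θ hP g₀ os).1 (sh F θ hP g₀ os).2 Wsh)
    (hrates : ∀ (F : T4Family) (θ : Stage13HParams F N) (hP : θ.Provisos₁₃CoPH F N), Rg F θ → θ.Admissible F N →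
      ForSmallCouplings (datumOfRecord₁₃CoPH F N θ hP) fun g₀ => ∀ os : List (ULoop F), P (datumOfRecord₁₃CoPH F N θ hP) (rr F θ hP g₀ os))
    (h19 : ∀ (F : T4Family) (θ : Stage13HParams F N) (hP : θ.Provisos₁₃CoPH F N), Rg F θ → θ.Admissible F N →
      ForSmallCouplings (datumOfRecord₁₃CoPH F N θ hP) fun g₀ => ∀ os : List (ULoop F),
        P (datumOfRecord₁₃CoPH F N θ hP) (rr F θ hP g₀ os) → letI : DecidableEq (Σ K, SiteSeqKey F (K₀ + K)) := Classical.decEq _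
          ∃ δ : ℕ → ℝ, NE7.Core 1 (F.side ^ 4) (classSet₁₃ θ K₀ g₀) (badClass₁₃ θ K₀ g₀ (jc F θ hP g₀ os)) (fun K t x => weightA₁₃ θ hP K₀ g₀ os K t x - (sh F θ hP g₀ os).1 K t x)
            (fun K t x => weightB₁₃ θ hP K₀ g₀ os K t x - (sh F θ hP g₀ os).2 K t x) δ ∧ Summable δ)
    (F : T4Family) (θ : Stage13HParams F N) (hP : θ.Provisos₁₃CoPH F N) (hRg : Rg F θ) (hθ : θ.Admissible F N) :
    ForSmallCouplings (datumOfRecord₁₃CoPH F N θ hP) fun g₀ => StringwiseHybridNE7 ((datumOfRecord₁₃CoPH F N θ hP).scheme g₀) :=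
  bodyBFree₁₃CoPH_of_keyedFacesP_bFree (fun F θ hP g₀ os => crOfRecord₁₃VAt K₀ (jc F θ hP g₀ os) sh F θ hP g₀ os) rr Rg P
    (fun F θ hP hRg hθ g₀ os => by
      obtain ⟨W, hW⟩ := h20 F θ hP hRg hθ g₀ os
      exact relWeightBound_crOfRecord₁₃VAt K₀ (jc F θ hP g₀ os) sh θ hP g₀ os hW)
    (fun F θ hP hRg hθ g₀ os => by
      obtain ⟨Wsh, hWsh⟩ := h21 F θ hP hRg hθ g₀ os
      exact shellWeightBound_crOfRecord₁₃VAt K₀ (jc F θ hP g₀ os) sh θ hP g₀ os hWsh)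
    hrates
    (fun F θ hP hRg hθ => (h19 F θ hP hRg hθ).mono fun g₀ hg os hPr => by
      letI : DecidableEq (Σ K, SiteSeqKey F (K₀ + K)) := Classical.decEq _
      obtain ⟨Wsh, hWsh⟩ := h21 F θ hP hRg hθ g₀ os
      obtain ⟨δ, hδ, hsum⟩ := hg os hPr
      exact ⟨_, core_crOfRecord₁₃VAt K₀ (jc F θ hP g₀ os) sh θ hP g₀ os (core_nonneg_of_shellWeightBound hWsh) hδ hsum⟩)
    (fun F θ hP hRg hθ => by
      obtain ⟨E, hE⟩ := hsel F θ hP hRg hθ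
      exact keyedExtraction_crOfRecord₁₃VAt_cut K₀ jc sh θ hP E hE (localBgMeasurable F N θ.ν) (hζm F θ hP hRg hθ) (zeta_nonneg_of_provisos₁₃CoPH F θ hP))
    F θ hP hRg hθ

variable (G : (F : T4Family) → Stage13HParams F N → Prop)

/-- ★★ **UC4 §2 IN THE BODY CURRENCY — ON THE LIVE LINE OF A REGIME `G`** (`Rg := G ∧ LiveSel` spelled `N`-generically; `hsel := hRg.2`).  At `N = 2`, `G :=` the guard,
`P := PHolderD4 β`, `rr := rrOfRecord 𝔯 ksel`, `K₀ = 0` the binders `hrates` ∕ `h19` ARE plan k3v6 §1V's `KeyedRatesHolderD4BFree β rr` ∕ the keyed-witness form of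
`KeyedCoreEdgeHolderD4BFree β cr rr` restricted to the live line. [bookkeeping] -/
theorem bodyBFree₁₃CoPH_live_at_crOfRecord₁₃VAt_cut_of_keyedFacesP_bFree
    (hζm : ∀ (F : T4Family) (θ : Stage13HParams F N), θ.Provisos₁₃CoPH F N → (G F θ ∧ θ.ppSel = ppSelLiveOfRecord F N θ.ν θ.τ9 (EOfRecord₁₃ F N θ.toStage13Params) (wOfRecord₉ F N θ.toStage9Params)) → θ.Admissible F N → ZetaMeasurable F N θ.ζ)
    (h20 : ∀ (F : T4Family) (θ : Stage13HParams F N) (hP : θ.Provisos₁₃CoPH F N), (G F θ ∧ θ.ppSel = ppSelLiveOfRecord F N θ.ν θ.τ9 (EOfRecord₁₃ F N θ.toStage13Params) (wOfRecord₉ F N θ.toStage9Params)) → θ.Admissible F N → ∀ (g₀ : ℕ → ℝ) (os : List (ULoop F)),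
      ∃ W : ℕ → ℝ, RelWeightBound 1 (classSet₁₃ θ K₀ g₀) (weightA₁₃ θ hP K₀ g₀ os) (weightB₁₃ θ hP K₀ g₀ os) (badClass₁₃ θ K₀ g₀ (jc F θ hP g₀ os)) W)
    (h21 : ∀ (F : T4Family) (θ : Stage13HParams F N) (hP : θ.Provisos₁₃CoPH F N), (G F θ ∧ θ.ppSel = ppSelLiveOfRecord F N θ.ν θ.τ9 (EOfRecord₁₃ F N θ.toStage13Params) (wOfRecord₉ F N θ.toStage9Params)) → θ.Admissible F N → ∀ (g₀ : ℕ → ℝ) (os : List (ULoop F)),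
      ∃ Wsh : ℕ → ℝ, ShellWeightBound 1 (classSet₁₃ θ K₀ g₀) (weightA₁₃ θ hP K₀ g₀ os) (weightB₁₃ θ hP K₀ g₀ os) (sh F θ hP g₀ os).1 (sh F θ hP g₀ os).2 Wsh)
    (hrates : ∀ (F : T4Family) (θ : Stage13HParams F N) (hP : θ.Provisos₁₃CoPH F N), (G F θ ∧ θ.ppSel = ppSelLiveOfRecord F N θ.ν θ.τ9 (EOfRecord₁₃ F N θ.toStage13Params) (wOfRecord₉ F N θ.toStage9Params)) → θ.Admissible F N →
      ForSmallCouplings (datumOfRecord₁₃CoPH F N θ hP) fun g₀ => ∀ os : List (ULoop F), P (datumOfRecord₁₃CoPH F N θ hP) (rr F θ hP g₀ os))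
    (h19 : ∀ (F : T4Family) (θ : Stage13HParams F N) (hP : θ.Provisos₁₃CoPH F N), (G F θ ∧ θ.ppSel = ppSelLiveOfRecord F N θ.ν θ.τ9 (EOfRecord₁₃ F N θ.toStage13Params) (wOfRecord₉ F N θ.toStage9Params)) → θ.Admissible F N →
      ForSmallCouplings (datumOfRecord₁₃CoPH F N θ hP) fun g₀ => ∀ os : List (ULoop F),
        P (datumOfRecord₁₃CoPH F N θ hP) (rr F θ hP g₀ os) → letI : DecidableEq (Σ K, SiteSeqKey F (K₀ + K)) := Classical.decEq _
          ∃ δ : ℕ → ℝ, NE7.Core 1 (F.side ^ 4) (classSet₁₃ θ K₀ g₀) (badClass₁₃ θ K₀ g₀ (jc F θ hP g₀ os)) (fun K t x => weightA₁₃ θ hP K₀ g₀ os K t x - (sh F θ hP g₀ os).1 K t x)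
            (fun K t x => weightB₁₃ θ hP K₀ g₀ os K t x - (sh F θ hP g₀ os).2 K t x) δ ∧ Summable δ)
    (F : T4Family) (θ : Stage13HParams F N) (hP : θ.Provisos₁₃CoPH F N)
    (hRg : G F θ ∧ θ.ppSel = ppSelLiveOfRecord F N θ.ν θ.τ9 (EOfRecord₁₃ F N θ.toStage13Params) (wOfRecord₉ F N θ.toStage9Params)) (hθ : θ.Admissible F N) :
    ForSmallCouplings (datumOfRecord₁₃CoPH F N θ hP) fun g₀ => StringwiseHybridNE7 ((datumOfRecord₁₃CoPH F N θ hP).scheme g₀) :=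
  bodyBFree₁₃CoPH_at_crOfRecord₁₃VAt_cut_of_keyedFacesP_bFree K₀ jc sh _ rr P (fun _ _ _ hRg _ => ⟨_, hRg.2⟩) hζm h20 h21 hrates h19 F θ hP hRg hθ

end Pinned

/-! ## §5 Off the live line at dag-n20-w1's ONE-TERM reading `crOneTerm₁₃ K₀` (p598780): the off-live body from ONE (B)-free Target row -/

section OffLive

variable {N : ℕ} [NeZero N] (K₀ : ℕ) (Rg : (F : T4Family) → Stage13HParams F N → Prop)
  (rr : (F : T4Family) → (θ : Stage13HParams F N) → θ.Provisos₁₃CoPH F N → (ℕ → ℝ) → List (ULoop F) → RateCarriers N)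
  (P : ∀ {F : T4Family}, Datum F N → RateCarriers N → Prop)

/-- ★★ **THE BODY ON A REGIME FROM ONE (B)-FREE TARGET ROW AT THE ONE-TERM READING** (HC4 §2's off-live side in the body currency): at `cr := crOneTerm₁₃ K₀` the N20 ∕ N21 ∕ N27x faces are
FREE (dag-n20-w1 `relWeightBound_∕shellWeightBound_∕extraction_crOneTerm₁₃`) and the N19′ face ⟸ node U5's Target on the partition functions from cutoff `K₀` on, given the rates, for all
small couplings — ONE displayed row `htarget`, (B)-FREE (transported through `core_crOneTerm₁₃_iff_target` inside `ForSmallCouplings.mono`).  NOT a discharge; the Target and the rates are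
HYPOTHESES (0∕1 today). [bookkeeping] -/
theorem bodyBFree₁₃CoPH_at_crOneTerm₁₃_of_target_bFree
    (hrates : ∀ (F : T4Family) (θ : Stage13HParams F N) (hP : θ.Provisos₁₃CoPH F N), Rg F θ → θ.Admissible F N →
      ForSmallCouplings (datumOfRecord₁₃CoPH F N θ hP) fun g₀ => ∀ os : List (ULoop F), P (datumOfRecord₁₃CoPH F N θ hP) (rr F θ hP g₀ os))
    (htarget : ∀ (F : T4Family) (θ : Stage13HParams F N) (hP : θ.Provisos₁₃CoPH F N), Rg F θ → θ.Admissible F N →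
      ForSmallCouplings (datumOfRecord₁₃CoPH F N θ hP) fun g₀ => ∀ os : List (ULoop F), P (datumOfRecord₁₃CoPH F N θ hP) (rr F θ hP g₀ os) →
        ∃ δ : ℕ → ℝ, Target ((F.side : ℝ) ^ 4) 1 δ (fun K => T4GenFunBounds.schemeZ ((datumOfRecord₁₃CoPH F N θ hP).scheme g₀) os (K₀ + K)))
    (F : T4Family) (θ : Stage13HParams F N) (hP : θ.Provisos₁₃CoPH F N) (hRg : Rg F θ) (hθ : θ.Admissible F N) :
    ForSmallCouplings (datumOfRecord₁₃CoPH F N θ hP) fun g₀ => StringwiseHybridNE7 ((datumOfRecord₁₃CoPH F N θ hP).scheme g₀) :=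
  bodyBFree₁₃CoPH_of_keyedFacesP_bFree (crOneTerm₁₃ K₀) rr Rg P
    (fun _ θ hP _ _ g₀ os => relWeightBound_crOneTerm₁₃ K₀ θ hP g₀ os) (fun _ θ hP _ _ g₀ os => shellWeightBound_crOneTerm₁₃ K₀ θ hP g₀ os) hrates
    (fun F θ hP hRg hθ => (htarget F θ hP hRg hθ).mono fun g₀ hg os hPr => (core_crOneTerm₁₃_iff_target K₀ θ hP g₀ os).2 (hg os hPr))
    (fun _ θ hP _ _ => ForSmallCouplings.of_forall fun g₀ os => extraction_crOneTerm₁₃ K₀ θ hP g₀ os) F θ hP hRg hθ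

end OffLive

end Summit.QuantumFields.YangMills.Theorems.BalabanUVNodesN27SpineRecord
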